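import Summits.CriticalPhenomena.PercolationContinuityZ3.Theorems.PercNearOneGluingNoHeavyQuantAD3FrechetHL
import Summits.CriticalPhenomena.PercolationContinuityZ3.Theorems.PercNearOneGluingNoHeavyQuantAD3Frechet
import HarnessLib

/-!
# QUANT lane R8, T-DEC, ROUTE 2: the cell `AD3FrechetCell` HOLDS — the two Fréchet laws of two admissible top-affordable pairs are
# admissible (all pair ⊗ pair kinds of `AD3ProdCell`)

builds on p205010 (kernel theorem, internal audit signed; external expert review pending)

Support file (`--supports stmt-CriticalPhenomena-4575`), QUANT lane, seat prim-quant-arm-2 (gen 37), rung R8 of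
`run/shared/lean/prim/quant/LADDER.md`; assembles `…QuantAD3FrechetHH` (heavy ⊗ heavy), `…QuantAD3FrechetHL` (heavy ⊗ light),
`…QuantAD3FrechetLL` (light ⊗ light) against lead g35's definitions `frCo` / `frCt` and the cell `AD3FrechetCell` (`…QuantAD3Frechet`).
Theorems only, standard axioms, no sorries.

THE CASES.  A pair is HEAVY (`y ≤ qγ`) or LIGHT (`qγ < y`; then admissibility gives `qT ≤ 2l`).  `frCo = if α ≤ β then TR[l₁+l₂, l₁+h₂,
h₁+h₂; 1−β, β−α, α] else TR[l₁+l₂, h₁+l₂, h₁+h₂; 1−α, α−β, β]`; `frCt = if 1 ≤ α+β then TR[l₁+h₂, h₁+l₂, h₁+h₂; 1−α, 1−β, α+β−1] else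
TR[l₁+l₂, l₁+h₂, h₁+l₂; 1−α−β, β, α]`.  H⊗H: `frCo_gate_decAt_HH_le/_gt`, `frCtSmall/Big_gate_decAt_HH`; H⊗L: `frCo_gate_decAt_HL` (shape
`β < α` — a heavy `α` and a light `β` never have `α ≤ β` unless vacuously), `frCtSmall/Big_gate_decAt_HL`; L⊗H: the same lemmas with the
two pairs exchanged (the laws are symmetric up to reordering atoms); L⊗L: `frechet_gate_decAt_LL`.

* **`LawDec.frechetCell_holds : AD3FrechetCell`.**
With lead g35's `ad3Decomp_lconv_TP_TP_of_frechet` (+ `ad3Decomp_of_admissibleTriple`), every product of two admissible pair components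
is AD3⁺ — the pair ⊗ pair kinds of `AD3ProdCell`.  HONEST STATUS: `AD3ProdCell` (triple kinds), `TreeBuiltAD3`, `FarTreeRow` OPEN; RATE
class log\* / honest sentence unchanged.

[this work]; Fréchet template and cell: lead g35 (this lane).  The gluing rows served [cite: KozmaNitzan2024, Conjecture 3 (p. 15)]; product
measure [cite: Grimmett1999, §1.3 p. 10].
-/

noncomputable section

namespace Summit.CriticalPhenomena.PercolationContinuityZ3.Theorems

namespace Quant

open Finset

/-- two-point law notation `TP[lo, hi, g, h] = g·[h = hi] + (1 − g)·[h = lo]` (as in the lane's other files). -/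
local notation3 "TP[" lo ", " hi ", " g ", " h "]" =>
  (g : ℝ) * (if (h : ℕ) = (hi : ℕ) then (1 : ℝ) else 0) + (1 - (g : ℝ)) * (if (h : ℕ) = (lo : ℕ) then (1 : ℝ) else 0)

/-- three-atom law notation `TR[s₁, s₂, s₃, p₁, p₂, p₃, h] = p₁·[h = s₁] + p₂·[h = s₂] + p₃·[h = s₃]`. -/
local notation3 "TR[" s₁ ", " s₂ ", " s₃ ", " p₁ ", " p₂ ", " p₃ ", " h "]" =>
  (p₁ : ℝ) * (if (h : ℕ) = (s₁ : ℕ) then (1 : ℝ) else 0) + (p₂ : ℝ) * (if (h : ℕ) = (s₂ : ℕ) then (1 : ℝ) else 0)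
    + (p₃ : ℝ) * (if (h : ℕ) = (s₃ : ℕ) then (1 : ℝ) else 0)

namespace LawDec

/-- **THE CELL `AD3FrechetCell` HOLDS.** [this work] -/
theorem frechetCell_holds : AD3FrechetCell := by
  intro y q α β M₁ M₂ l₁ h₁ l₂ h₂ hy0 hyq hq1 hl₁ hh₁ hl₂ hh₂ hα0 hα1 hβ0 hβ1 hta₁ hta₂ hD₁ hD₂
  have hM : M₂ + M₁ = M₁ + M₂ := Nat.add_comm _ _
  refine ⟨?_, ?_⟩
  · -- the comonotone law
    by_cases hαβ : α ≤ β
    · have e : frCo l₁ h₁ l₂ h₂ α β = fun h => TR[l₁ + l₂, l₁ + h₂, h₁ + h₂, 1 - β, β - α, α, h] := by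
        funext h; simp only [frCo, if_pos hαβ]
      rw [e]
      by_cases hA : y ≤ q * α
      · -- A heavy; then B heavy as well (`qβ ≥ qα ≥ y`)
        have hB : y ≤ q * β := le_trans hA (by nlinarith [lt_trans hy0 hyq])
        exact frCo_gate_decAt_HH_le y q α β M₁ M₂ l₁ h₁ l₂ h₂ hy0 hyq hq1 hl₁ hh₁ hl₂ hh₂ hβ1 hA hta₁ hta₂ hαβ
      · rw [not_le] at hA
        by_cases hB : y ≤ q * β
        · -- L⊗H: the H⊗L lemma with the pairs exchanged
          intro j' hj'
          have := frCo_gate_decAt_HL y q β α M₂ M₁ l₂ h₂ l₁ h₁ hy0 hyq hq1 hl₂ hh₂ hl₁ hh₁ hβ1 hα0 hα1 hB hA hta₂ hta₁ hD₁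
            j' (by omega)
          rw [hM, show l₂ + l₁ = l₁ + l₂ by omega, show h₂ + l₁ = l₁ + h₂ by omega, show h₂ + h₁ = h₁ + h₂ by omega] at this
          exact this
        · rw [not_le] at hB
          exact (frechet_gate_decAt_LL y q α β M₁ M₂ l₁ h₁ l₂ h₂ hy0 hyq hq1 hl₁ hh₁ hl₂ hh₂ hα0 hα1 hβ0 hβ1 hA hB hta₁ hta₂
            hD₁ hD₂).1 hαβ
    · rw [not_le] at hαβ
      have e : frCo l₁ h₁ l₂ h₂ α β = fun h => TR[l₁ + l₂, h₁ + l₂, h₁ + h₂, 1 - α, α - β, β, h] := by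
        funext h; simp only [frCo, if_neg (not_le.2 hαβ)]
      rw [e]
      by_cases hB : y ≤ q * β
      · have hA : y ≤ q * α := le_trans hB (by nlinarith [lt_trans hy0 hyq])
        exact frCo_gate_decAt_HH_gt y q α β M₁ M₂ l₁ h₁ l₂ h₂ hy0 hyq hq1 hl₁ hh₁ hl₂ hh₂ hα1 hB hta₁ hta₂ hαβ.le
      · rw [not_le] at hB
        by_cases hA : y ≤ q * α
        · exact frCo_gate_decAt_HL y q α β M₁ M₂ l₁ h₁ l₂ h₂ hy0 hyq hq1 hl₁ hh₁ hl₂ hh₂ hα1 hβ0 hβ1 hA hB hta₁ hta₂ hD₂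
        · rw [not_le] at hA
          exact (frechet_gate_decAt_LL y q α β M₁ M₂ l₁ h₁ l₂ h₂ hy0 hyq hq1 hl₁ hh₁ hl₂ hh₂ hα0 hα1 hβ0 hβ1 hA hB hta₁ hta₂
            hD₁ hD₂).2.1 hαβ.le
  · -- the countermonotone law
    by_cases hbig : 1 ≤ α + β
    · have e : frCt l₁ h₁ l₂ h₂ α β = fun h => TR[l₁ + h₂, h₁ + l₂, h₁ + h₂, 1 - α, 1 - β, α + β - 1, h] := by
        funext h; simp only [frCt, if_pos hbig]
      rw [e]
      by_cases hA : y ≤ q * α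
      · by_cases hB : y ≤ q * β
        · exact frCtBig_gate_decAt_HH y q α β M₁ M₂ l₁ h₁ l₂ h₂ hy0 hyq hq1 hl₁ hh₁ hl₂ hh₂ hα1 hβ1 hA hB hta₁ hta₂ hbig
        · rw [not_le] at hB
          exact frCtBig_gate_decAt_HL y q α β M₁ M₂ l₁ h₁ l₂ h₂ hy0 hyq hq1 hl₁ hh₁ hl₂ hh₂ hα1 hβ0 hβ1 hA hB hta₁ hta₂ hD₂ hbig
      · rw [not_le] at hA
        by_cases hB : y ≤ q * β
        · -- L⊗H: exchange the pairs and the first two atoms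
          intro j' hj'
          have := frCtBig_gate_decAt_HL y q β α M₂ M₁ l₂ h₂ l₁ h₁ hy0 hyq hq1 hl₂ hh₂ hl₁ hh₁ hβ1 hα0 hα1 hB hA hta₂ hta₁ hD₁
            (by linarith) j' (by omega)
          rw [hM, TR_swap12, show l₂ + h₁ = h₁ + l₂ by omega, show h₂ + l₁ = l₁ + h₂ by omega, show h₂ + h₁ = h₁ + h₂ by omega,
            show β + α - 1 = α + β - 1 by ring] at this
          exact this
        · rw [not_le] at hB
          exact (frechet_gate_decAt_LL y q α β M₁ M₂ l₁ h₁ l₂ h₂ hy0 hyq hq1 hl₁ hh₁ hl₂ hh₂ hα0 hα1 hβ0 hβ1 hA hB hta₁ hta₂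
            hD₁ hD₂).2.2.2 hbig
    · rw [not_le] at hbig
      have e : frCt l₁ h₁ l₂ h₂ α β = fun h => TR[l₁ + l₂, l₁ + h₂, h₁ + l₂, 1 - α - β, β, α, h] := by
        funext h; simp only [frCt, if_neg (not_le.2 hbig)]
      rw [e]
      by_cases hA : y ≤ q * α
      · by_cases hB : y ≤ q * β
        · exact frCtSmall_gate_decAt_HH y q α β M₁ M₂ l₁ h₁ l₂ h₂ hy0 hyq hq1 hl₁ hh₁ hl₂ hh₂ hA hB hta₁ hta₂ hbig.le
        · rw [not_le] at hB
          exact frCtSmall_gate_decAt_HL y q α β M₁ M₂ l₁ h₁ l₂ h₂ hy0 hyq hq1 hl₁ hh₁ hl₂ hh₂ hβ0 hβ1 hA hB hta₁ hta₂ hD₂ hbig.le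
      · rw [not_le] at hA
        by_cases hB : y ≤ q * β
        · -- L⊗H: exchange the pairs and the last two atoms
          intro j' hj'
          have := frCtSmall_gate_decAt_HL y q β α M₂ M₁ l₂ h₂ l₁ h₁ hy0 hyq hq1 hl₂ hh₂ hl₁ hh₁ hα0 hα1 hB hA hta₂ hta₁ hD₁
            (by linarith) j' (by omega)
          rw [hM, TR_swap23, show l₂ + l₁ = l₁ + l₂ by omega, show l₂ + h₁ = h₁ + l₂ by omega, show h₂ + l₁ = l₁ + h₂ by omega,
            show 1 - β - α = 1 - α - β by ring] at this
          exact this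
        · rw [not_le] at hB
          exact (frechet_gate_decAt_LL y q α β M₁ M₂ l₁ h₁ l₂ h₂ hy0 hyq hq1 hl₁ hh₁ hl₂ hh₂ hα0 hα1 hβ0 hβ1 hA hB hta₁ hta₂
            hD₁ hD₂).2.2.1 hbig.le

end LawDec

end Quant

end Summit.CriticalPhenomena.PercolationContinuityZ3.Theorems
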